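import Mathlib
import Literature.MathematicalPhysics.QuantumLattice.WilsonDiracAP
import Summits.QuantumFields.QCD.Theorems.QuarksAsStableActionCriticalLineDiamagnetismStubGaugeCoercive

/-!
# The cell Wilson form in Coulomb gauge on the `2⁴` block
(auxiliary file; helper for crux stmt-QuantumFields-9734, line `Sketch`, stub `stub_blockReduction`)

What.  On the `2⁴` block (`TorusSite 4 2 = Fin 4 → ZMod 2`) let `g : Edge 4 2 → ℝ` be a TILING-ODD
real link field, `g(x + μ̂, μ) = -g(x, μ)`, with Walsh components `v_μ(s) = Σ_x χ_s(x) g(x,μ)` for the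
sixteen real characters `χ_s(x) = (−1)^{Σ_κ s_κ x_κ}`, and let
`L(x) = Σ_s (χ_s(x) / (32 n_s)) Σ_μ v_μ(s)` (`n_s = #{μ : s_μ = 1}`) be the Coulomb gauge generator of
`…StubGaugeCoercive`.  For the Walsh components `w_μ(s) = Σ_x χ_s(x) (g − dL)(x,μ)` of the gauged
field `g − dL`, `dL(x,μ) = L(x) − L(x + μ̂)`, we prove (`stub_blockReductionAux`):
* `w_μ(s) = 0` unless `s_μ = 1` (support on the active directions),
* `Σ_μ w_μ(s) = 0` for every class `s` (Coulomb gauge),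
* the cell Wilson form is diagonal: `Σ_{x, i<j} (g(x,i) + g(x+î,j) − g(x+ĵ,i) − g(x,j))² = ¼ Σ_s n_s Σ_μ w_μ(s)²`.

How.  Adapted from `GaugeCoercive.core` (same generator, equality instead of the inequality):
Plancherel plaquette orientation by orientation, the shift rule `Σ_x χ_s(x) h(x + μ̂) = (−1)^{s_μ} ĥ(s)`,
Fourier inversion for `L`, and an elementary identity for `4`-vectors per Walsh class
(`per_class_eq`, sixteen sign patterns closed by `ring`).  The characters `(−1)^{Σ s_κ x_κ}` of the
block-Hessian formula (`…StubBlockHessianFormula`) are the products of signs used in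
`…StubGaugeCoercive` (`chi_eq_prod`).

Sources: folklore (discrete Hodge/Walsh decomposition on the hypercube).  Pure theorem file (no `def`s).
-/

noncomputable section

open scoped BigOperators Classical Matrix ComplexConjugate
open Finset
open Literature.MathematicalPhysics.QuantumLattice Literature.MathematicalPhysics.QuantumFieldTheory
  Literature.Probability.LatticeModels

namespace Summit.QuantumFields.QCD.Cruxes.CriticalLineDiamagnetism.ChessboardCellGain

namespace BlockReduction

/-! ### The two descriptions of the Walsh characters agree -/

/-- On `ℤ/2`: `(−1)^{val a · val b} = sgn(a b)`. -/
theorem neg_one_pow_val_mul (a b : ZMod 2) :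
    (-1 : ℝ) ^ (a.val * b.val) = if a * b = 0 then 1 else -1 := by
  have z2 : ∀ c : ZMod 2, c = 0 ∨ c = 1 := by decide
  have hv1 : (1 : ZMod 2).val = 1 := rfl
  rcases z2 a with rfl | rfl <;> rcases z2 b with rfl | rfl <;> simp [hv1]

/-- `(−1)^{Σ_κ s_κ x_κ} = Π_μ sgn(s_μ x_μ)`: the characters of `…StubBlockHessianFormula` are those of
`…StubGaugeCoercive`. -/
theorem chi_eq_prod (s x : TorusSite 4 2) :
    (-1 : ℝ) ^ (∑ κ, (s κ).val * (x κ).val) = ∏ μ, if s μ * x μ = 0 then (1 : ℝ) else -1 := by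
  rw [← Finset.prod_pow_eq_pow_sum]
  exact Finset.prod_congr rfl fun μ _ => neg_one_pow_val_mul (s μ) (x μ)

/-- The number of active directions of a Walsh class, as a real sum of indicators. -/
theorem card_active (s : Fin 4 → ZMod 2) :
    ((Finset.univ.filter fun μ : Fin 4 => s μ = 1).card : ℝ) = ∑ μ, if s μ = 0 then (0 : ℝ) else 1 := by
  rw [Finset.card_filter, Nat.cast_sum]
  refine Finset.sum_congr rfl fun μ _ => ?_
  have z2 : ∀ c : ZMod 2, c = 0 ∨ c = 1 := by decide
  have h10 : (1 : ZMod 2) ≠ 0 := by decide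
  rcases z2 (s μ) with h | h <;> simp [h, h10]

/-! ### The elementary identity per Walsh class -/

/-- For a `4`-vector `v` supported on the active set `{μ : s_μ = 1}` (of size `n`) and the mean
`c = (Σ v) / (32 n)`: the gauged vector `v_μ − 32·[s_μ = 1]·c` sums to zero, and
`(1/16) Σ_{i<j} (2[s_j = 1] v_i − 2[s_i = 1] v_j)² = ¼ · n · Σ_μ (v_μ − 32·[s_μ = 1]·c)²`
(sixteen sign patterns, each closed by `ring`). -/
theorem per_class_eq (s : Fin 4 → ZMod 2) (v : Fin 4 → ℝ)
    (hv : ∀ μ, v μ = (if s μ = 0 then 0 else 1) * v μ) :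
    (∑ μ, (v μ - 32 * (if s μ = 0 then 0 else 1) *
        ((∑ ν, v ν) / (32 * ∑ ν, if s ν = 0 then (0 : ℝ) else 1))) = 0) ∧
    ∑ q : {p : Fin 4 × Fin 4 // p.1 < p.2}, 1 / 16 *
        (2 * (if s q.1.2 = 0 then 0 else 1) * v q.1.1 -
          2 * (if s q.1.1 = 0 then 0 else 1) * v q.1.2) ^ 2 =
      1 / 4 * ((∑ ν, if s ν = 0 then (0 : ℝ) else 1) *
        ∑ μ, (v μ - 32 * (if s μ = 0 then 0 else 1) *
          ((∑ ν, v ν) / (32 * ∑ ν, if s ν = 0 then (0 : ℝ) else 1))) ^ 2) := by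
  have z2 : ∀ c : ZMod 2, c = 0 ∨ c = 1 := by decide
  constructor
  · simp only [Fin.sum_univ_four]
    rw [hv 0, hv 1, hv 2, hv 3]
    rcases z2 (s 0) with h0 | h0 <;> rcases z2 (s 1) with h1 | h1 <;>
      rcases z2 (s 2) with h2 | h2 <;> rcases z2 (s 3) with h3 | h3 <;>
      simp [h0, h1, h2, h3] <;> ring
  · rw [GaugeCoercive.sum_pairs (fun p : Fin 4 × Fin 4 => 1 / 16 *
      (2 * (if s p.2 = 0 then 0 else 1) * v p.1 - 2 * (if s p.1 = 0 then 0 else 1) * v p.2) ^ 2)]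
    simp only [Fin.sum_univ_four]
    rw [hv 0, hv 1, hv 2, hv 3]
    rcases z2 (s 0) with h0 | h0 <;> rcases z2 (s 1) with h1 | h1 <;>
      rcases z2 (s 2) with h2 | h2 <;> rcases z2 (s 3) with h3 | h3 <;>
      simp [h0, h1, h2, h3] <;> ring

end BlockReduction

open BlockReduction in
/-- **Registered sub-goal of this auxiliary file** (`stub_blockReductionAux`, the Coulomb gauge on the
`2⁴` block for a real tiling-odd link field `g`): with the Walsh characters `χ_s(x) = (−1)^{Σ s_κ x_κ}`,
the generator `L(x) = Σ_s (χ_s(x)/(32 n_s)) Σ_μ Σ_y χ_s(y) g(y,μ)` and the Walsh components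
`w_μ(s) = Σ_x χ_s(x) (g(x,μ) − (L(x) − L(x+μ̂)))` of the gauged field: `w_μ(s) = 0` for `s_μ = 0`,
`Σ_μ w_μ(s) = 0`, and `Σ_p (curl g)_p² = ¼ Σ_s n_s Σ_μ w_μ(s)²`. -/
theorem stub_blockReductionAux : ∀ (χ : (Fin 4 → ZMod 2) → TorusSite 4 2 → ℝ), (∀ s x, χ s x = (-1 : ℝ) ^ (∑ κ : Fin 4, (s κ).val * (x κ).val)) → ∀ (g : Edge 4 2 → ℝ), (∀ (x : TorusSite 4 2) (μ : Fin 4), g (Site.shift x μ, μ) = -g (x, μ)) → ∀ (L : TorusSite 4 2 → ℝ), (∀ x, L x = ∑ s : Fin 4 → ZMod 2, χ s x / (32 * ((Finset.univ.filter (fun μ : Fin 4 => s μ = 1)).card : ℝ)) * ∑ μ : Fin 4, ∑ y : TorusSite 4 2, χ s y * g (y, μ)) → ∀ (w : (Fin 4 → ZMod 2) → Fin 4 → ℝ), (∀ s μ, w s μ = ∑ x : TorusSite 4 2, χ s x * (g (x, μ) - (L x - L (Site.shift x μ)))) → (∀ s μ, s μ = 0 → w s μ = 0) ∧ (∀ s,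 ∑ μ, w s μ = 0) ∧ ∑ p : Plaquette 4 2, (g (p.1, p.2.1.1) + g (Site.shift p.1 p.2.1.1, p.2.1.2) - g (Site.shift p.1 p.2.1.2, p.2.1.1) - g (p.1, p.2.1.2)) ^ 2 = (1 / 4 : ℝ) * ∑ s : Fin 4 → ZMod 2, ((Finset.univ.filter (fun μ : Fin 4 => s μ = 1)).card : ℝ) * ∑ μ, w s μ ^ 2 := by
  intro χ hχ' g hg L hL w hw
  -- adapted from `GaugeCoercive.core` (…StubGaugeCoercive)
  have hχ : ∀ s x, χ s x = ∏ μ, if s μ * x μ = 0 then (1 : ℝ) else -1 := fun s x => by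
    rw [hχ', chi_eq_prod]
  -- Walsh components of `g`, direction by direction, and the Walsh coefficients of `L`
  obtain ⟨v, hv⟩ : ∃ v : Fin 4 → TorusSite 4 2 → ℝ,
      ∀ μ s, v μ s = ∑ x, χ s x * g (x, μ) := ⟨_, fun _ _ => rfl⟩
  obtain ⟨c, hc⟩ : ∃ c : TorusSite 4 2 → ℝ,
      ∀ s, c s = (∑ μ, v μ s) / (32 * ∑ ν, if s ν = 0 then (0 : ℝ) else 1) :=
    ⟨_, fun _ => rfl⟩
  -- shifted transforms
  have hgshift : ∀ s μ ν,
      ∑ x, χ s x * g (Site.shift x μ, ν) = (if s μ = 0 then 1 else -1) * v ν s := by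
    intro s μ ν
    rw [hv]
    exact GaugeCoercive.transform_shift χ hχ (fun x => g (x, ν)) s μ
  -- inactive components vanish (tiling-oddness)
  have hv0 : ∀ μ s, v μ s = (if s μ = 0 then 0 else 1) * v μ s := by
    intro μ s
    split_ifs with h
    · have h1 : ∑ x, χ s x * g (Site.shift x μ, μ) = v μ s := by
        rw [hgshift, if_pos h, one_mul]
      have h2 : ∑ x, χ s x * g (Site.shift x μ, μ) = -v μ s := by
        simp only [hg, mul_neg, Finset.sum_neg_distrib, hv]
      linarith
    · rw [one_mul]
  -- `L` in Walsh form, and its transform (Fourier inversion)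
  have hL' : ∀ x, L x = ∑ s, χ s x * c s := fun x => by
    rw [hL]
    refine Finset.sum_congr rfl fun s _ => ?_
    rw [hc, card_active, div_mul_eq_mul_div, mul_div_assoc]
    simp only [hv]
  have hLhat : ∀ s, ∑ x, χ s x * L x = 16 * c s := fun s => by
    simp only [hL', Finset.mul_sum]
    rw [Finset.sum_comm]
    have h1 : ∀ t, ∑ x, χ s x * (χ t x * c t) = (if s = t then 16 else 0) * c t := fun t => by
      rw [← GaugeCoercive.sum_chi_mul_right χ hχ s t, Finset.sum_mul]
      exact Finset.sum_congr rfl fun x _ => by ring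
    simp only [h1, ite_mul, zero_mul, Finset.sum_ite_eq, Finset.mem_univ, if_true]
  have hLshift : ∀ s μ,
      ∑ x, χ s x * L (Site.shift x μ) = (if s μ = 0 then 1 else -1) * (16 * c s) :=
    fun s μ => by rw [GaugeCoercive.transform_shift χ hχ L s μ, hLhat]
  -- the gauged Walsh components
  have hw' : ∀ s μ, w s μ = v μ s - 32 * (if s μ = 0 then 0 else 1) * c s := by
    intro s μ
    rw [hw]
    simp only [mul_sub, Finset.sum_sub_distrib, ← hv, hLshift, hLhat]
    split_ifs <;> ring
  -- the cell Wilson form in Walsh variables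
  have rhs : ∑ p : Plaquette 4 2, (g (p.1, p.2.1.1) + g (Site.shift p.1 p.2.1.1, p.2.1.2) -
        g (Site.shift p.1 p.2.1.2, p.2.1.1) - g (p.1, p.2.1.2)) ^ 2 =
      ∑ s, ∑ q : {p : Fin 4 × Fin 4 // p.1 < p.2}, 1 / 16 *
        (2 * (if s q.1.2 = 0 then 0 else 1) * v q.1.1 s -
          2 * (if s q.1.1 = 0 then 0 else 1) * v q.1.2 s) ^ 2 := by
    calc _ = ∑ q : {p : Fin 4 × Fin 4 // p.1 < p.2}, ∑ x : TorusSite 4 2,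
          (g (x, q.1.1) + g (Site.shift x q.1.1, q.1.2) - g (Site.shift x q.1.2, q.1.1) -
            g (x, q.1.2)) ^ 2 := by
          rw [Fintype.sum_prod_type]
          exact Finset.sum_comm
      _ = ∑ q : {p : Fin 4 × Fin 4 // p.1 < p.2}, 1 / 16 * ∑ s,
          (2 * (if s q.1.2 = 0 then 0 else 1) * v q.1.1 s -
            2 * (if s q.1.1 = 0 then 0 else 1) * v q.1.2 s) ^ 2 := by
          refine Finset.sum_congr rfl fun q _ => ?_
          rw [GaugeCoercive.plancherel χ hχ]
          congr 1
          refine Finset.sum_congr rfl fun s _ => ?_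
          congr 1
          simp only [mul_add, mul_sub, Finset.sum_add_distrib, Finset.sum_sub_distrib, ← hv,
            hgshift]
          split_ifs <;> ring
      _ = _ := by
          simp only [Finset.mul_sum]
          exact Finset.sum_comm
  refine ⟨fun s μ hμ => ?_, fun s => ?_, ?_⟩
  · rw [hw', hv0 μ s, if_pos hμ]
    ring
  · simp only [hw', hc]
    exact (per_class_eq s (fun μ => v μ s) (fun μ => hv0 μ s)).1
  · rw [rhs, Finset.mul_sum]
    refine Finset.sum_congr rfl fun s _ => ?_
    rw [card_active]
    simp only [hw', hc]
    exact (per_class_eq s (fun μ => v μ s) (fun μ => hv0 μ s)).2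

end Summit.QuantumFields.QCD.Cruxes.CriticalLineDiamagnetism.ChessboardCellGain

end
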